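import Summits.BirchSwinnertonDyer.BirchSwinnertonDyer.Theorems.EdixhovenFibreFiveSevenStarredOptimalManinUnitFiveSevenSemiLocalIntegralityPin
import HarnessLib

/-!
# F″ programme, piece P4-coh — PER-CURVE de Rham re-key: `Ψ (Λ y) w ∈ 𝒪_w` from the de Rham-ness of `V_pW|_{Γ_{ℚ_p}}`
# of THIS curve (no universal `isDeRham_restrictedRationalTateRep`)
# (route `EdixhovenFibreFiveSeven`, crux K★ stmt-BirchSwinnertonDyer-22226, line `kato-lever`; seat `bsd-line-edix-p4` g9)

HONEST FRAMING. TOOL theorems only (no definition, no named fact, no `sorry`); nothing is closed or booked; BSD is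
not proved by any of this. Sequel of `…SemiLocalIntegralityPin` (seat edix-p3 g4, p603458).

WHY (memo `Cruxes/StarredOptimalManinUnitFiveSeven/Lines/kato-lever-hDR-programme.md` v3.1 §3 (g), and §A″ of
`Lines/kato-lever-hDR-neron-datum.md`). The cite-only fact hDR `PAdicHodge.isDeRham_restrictedRationalTateRep` ("`V_pE` is
de Rham for EVERY elliptic curve over every subfield of every `p`-adic field") enters Kato's Néron integrality F″ ONLY
through `…SemiLocalIntegrality.semilocal_mem_adicCompletionIntegers_of_pin_of_semi` (§3 of the Pin file), and there
only at ONE curve `W` and ONE prime `p`: via `KimAtThreeDeepUpperExpStarFacts.hinj_hex_of_facts` (Kato II Prop. 1.2.3 at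
`ℚ_v`, `v = (p)`) and `KimAtThreeDeepUpperExpStarFactsTower.isDeRham_localRationalTateRep_comp_of_facts` (ascent to the
factor fields `L_w = ℚ(ζ_m)_w ⊇ ℚ_v`, Brinon–Conrad 6.3.8, a tree theorem). Meanwhile de Rham-ness of `V_pW|_{Γ_{ℚ_v}}`
is a tree THEOREM for large classes of curves (good ordinary / potentially good ordinary over `ℚ`:
`isDeRham_restrictedRationalTateRep_adicCompletion[_rat]_of_potentiallyGoodOrdinary`, `…_of_typeGOrd`, the three
(G)-ordinary K★ cells `…_of_starred_ordinaryCell`; CM at odd split `p`). This file re-keys §3 on the PER-CURVE hypothesis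

  `hDRv : GaloisRep.IsDeRham (bdRPeriodRingData (valuation_place_lt_one p v)) (localRationalTateRep W p (galRestrictPlace v))`

(`v = (p)`; the Literature `restrictedRationalTateRep W ℚ_v p` IS this representation, `rfl`), so that the F″ chain
downstream (per-class socket, levers, closers — sibling files) consumes de Rham-ness only where the tree proves it.

* §1 `hinj_hex_of_isDeRhamAt`, `isDeRham_localRationalTateRep_comp_of_isDeRhamAt`, `hinj_hex_comp_of_isDeRhamAt` — the
  per-curve twins of the kim3 helpers (`…_of_facts`), same conclusions, hypothesis `hDRv` instead of hDR.
* §2 ★ `semilocal_mem_adicCompletionIntegers_of_pin_of_semi_of_isDeRhamAt` — §3 of the Pin file VERBATIM with `hDR`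
  replaced by `hDRv` (binders otherwise byte-identical, so the consumer `KatoAssemblySocket` re-keys by substitution);
  Kato's Prop. 1.2.3 `hP` stays displayed here (it is a tree THEOREM, `cupLogInjective_and_hasDualExp_of_isDeRham_holds`,
  file `KatoH1BdRFilHolds`; the per-class socket downstream discharges it).

References: [Kato2004Asterisque] §9.4 (p. 188), Thm. 9.7 (p. 189); [Kato1993LNM1553] Ch. II Prop. 1.2.3, §1.2.4,
Ex. 1.3.5, Thm. 1.4.1 (3)–(4); [BlochKato1990] §3 Prop. 3.8, Ex. 3.11; [BrinonConrad2009] Prop. 6.3.8;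
[KimNakamura2020] Cor. 2.4; [CasselsFrohlichANT1967] Ch. II §10 Theorem (10.2).
-/

set_option autoImplicit false
-- the Theorems namespace of a single-conjunct summit repeats the summit name by design (D-0017)
set_option linter.dupNamespace false

noncomputable section

open scoped NumberField NNReal Classical TensorProduct
open Field ValuativeRel IsDedekindDomain NumberField
open Literature.NumberTheory.GaloisRepresentations
open Literature.NumberTheory.GaloisRepresentations.PeriodRingData
open Literature.NumberTheory.PAdicHodge
open Literature.NumberTheory.EllipticCurves WeierstrassCurve
open Literature.NumberTheory.EllipticCurves.FormalGroupChart (padicLogPointFiniteExt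
  isIntegral_valuationInteger_of_isIntegral_padicInt)
open Summit.BirchSwinnertonDyer.BirchSwinnertonDyer.Theorems.KimAtThreeDeepLowerExpStarOmega
open Summit.BirchSwinnertonDyer.BirchSwinnertonDyer.Theorems.KimAtThreeDeepLowerExpStarOmegaPlace
open Summit.BirchSwinnertonDyer.BirchSwinnertonDyer.Theorems.KimAtThreeDeepUpperExpStarTransport
open Summit.BirchSwinnertonDyer.BirchSwinnertonDyer.Theorems.KimAtThreeDeepUpperExpStarFacts
open Summit.BirchSwinnertonDyer.BirchSwinnertonDyer.Theorems.KimAtThreeDeepUpperExpStarFactsCanonical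
  (ringHom_place_padic_ext)
open Summit.BirchSwinnertonDyer.Rank1Residual.GaloisImage
open Summit.BirchSwinnertonDyer.Rank1Residual.Additive (LocalLog.padicLog)
open Rat.HeightOneSpectrum
open Summit.BirchSwinnertonDyer.BirchSwinnertonDyer.Theorems.SemiLocalIntegrality

namespace Summit.BirchSwinnertonDyer.BirchSwinnertonDyer.Theorems.SemiLocalIntegralityAt

/-! ## §1 The per-curve twins of the kim3 helpers: Prop. 1.2.3 binders and tower ascent from `hDRv` -/

section Helpers

variable (W : WeierstrassCurve ℚ) [W.IsElliptic] (p : ℕ) [Fact p.Prime]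
  (v : HeightOneSpectrum (𝓞 ℚ)) [hv : Fact (((p : ℕ) : 𝓞 ℚ) ∈ v.asIdeal)]

-- FILE-LOCAL instance keys, byte-identical to the accepted `KimAtThreeDeepUpperExpStarFacts.lean` l.76–79 (no library
-- instance is overridden outside this file): the tree's `ℚ`-algebra structure on `ℚ_v` first, then the local-field
-- structures on `ℚ_v = Place.Completion (inr v)` under which the W2 cell's `exp*_ω` API is stated.
attribute [local instance 100000] NumberField.Place.instAlgebraCompletion
attribute [local instance] valuativeRelPlace topologicalSpacePlace
attribute [local instance] isNonarchimedeanLocalField_place charZero_place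
attribute [local instance] padicAlgebraPlace fact_not_isUnit_place isAdicComplete_place

/-- **`hinj` / `hex` at the place from Kato's Prop. 1.2.3 and the de Rham-ness of `V_pW|_{Γ_{ℚ_v}}` of THIS curve**
(per-curve twin of `KimAtThreeDeepUpperExpStarFacts.hinj_hex_of_facts`; the Literature `restrictedRationalTateRep W ℚ_v p`
is `localRationalTateRep W p (galRestrictPlace v)` definitionally). [cite: Kato1993LNM1553, Ch. II Prop. 1.2.3 and Ex. 1.3.5] -/
theorem hinj_hex_of_isDeRhamAt (hP : cupLogInjective_and_hasDualExp_of_isDeRham)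
    (hDRv : GaloisRep.IsDeRham (bdRPeriodRingData (valuation_place_lt_one p v))
      (localRationalTateRep W p (galRestrictPlace v))) :
    (bdRPeriodRingData (valuation_place_lt_one p v)).CupLogInjective (logCyclotomic p)
        (localRationalTateRep W p (galRestrictPlace v)) ∧
      ∀ z : contOneCocycles (localRationalTateRep W p (galRestrictPlace v)).toTopRep,
        (bdRPeriodRingData (valuation_place_lt_one p v)).HasDualExp (logCyclotomic p)
          (localRationalTateRep W p (galRestrictPlace v)) fun σ => z.1 σ := by
  haveI : Module.Finite ℚ_[p] (W.rationalTateModule p) := WeierstrassCurve.module_finite_rationalTateModule_holds W p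
  exact hP (valuation_place_lt_one p v) (restrictedRationalTateRep W _ p) hDRv

variable {L : Type} [Field L] [ValuativeRel L] [TopologicalSpace L] [IsNonarchimedeanLocalField L]
  [CharZero L] [Algebra (Place.Completion (Sum.inr v : Place ℚ)) L]
  [Fact (¬ IsUnit (p : integerC L))] [IsAdicComplete (Ideal.span {(p : integerC L)}) (integerC L)]
  (hL : valuation L p < 1)

/-- **`V_pW|_{Γ_L}` along the tower `Γ_L → Γ_{ℚ_v} → Γ_ℚ` is de Rham once `V_pW|_{Γ_{ℚ_v}}` is** (for the canonical
`ℚ_p`-structure `LocalField.padicAlgebra L p hL`; per-curve twin of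
`KimAtThreeDeepUpperExpStarFactsTower.isDeRham_localRationalTateRep_comp_of_facts`): the tree's
`isAdmissible_bdR_restrictField` along the continuous embedding `ℚ_v → L` (Brinon–Conrad Prop. 6.3.8).
[cite: BrinonConrad2009, Prop. 6.3.8] [cite: Kato1993LNM1553, Ch. II Ex. 1.3.5] -/
theorem isDeRham_localRationalTateRep_comp_of_isDeRhamAt
    (hDRv : GaloisRep.IsDeRham (bdRPeriodRingData (valuation_place_lt_one p v))
      (localRationalTateRep W p (galRestrictPlace v)))
    (hcont : Continuous (algebraMap (Place.Completion (Sum.inr v : Place ℚ)) L)) :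
    letI := LocalField.padicAlgebra L p hL
    GaloisRep.IsDeRham (bdRPeriodRingData (F := L) (p := p) hL)
      (localRationalTateRep W p
        ((galRestrictPlace v).comp (absGaloisRestrict (Place.Completion (Sum.inr v : Place ℚ)) L))) := by
  letI := LocalField.padicAlgebra L p hL
  haveI : Module.Finite ℚ_[p] (W.rationalTateModule p) :=
    WeierstrassCurve.module_finite_rationalTateModule_holds W p
  exact isAdmissible_bdR_restrictField (K := Place.Completion (Sum.inr v : Place ℚ)) (L := L) (ℓ := p) hcont
    (valuation_place_lt_one p v) hL (padicAlgebraPlace p v) _ rfl rfl (LocalField.padicAlgebra L p hL) _ rfl rfl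
    (localRationalTateRep W p (galRestrictPlace v)) hDRv

/-- **The Prop-1.2.3 binders `hinjw` / `hexw` at a factor field `L ⊇ ℚ_v`** for the tower representation, from Kato's
Prop. 1.2.3 (`hP`) and the de Rham-ness of `V_pW|_{Γ_{ℚ_v}}` of THIS curve (per-curve twin of
`KimAtThreeDeepUpperExpStarFactsTower.hinj_hex_comp_of_facts`).
[cite: Kato1993LNM1553, Ch. II Prop. 1.2.3 and Ex. 1.3.5] [cite: BrinonConrad2009, Prop. 6.3.8] -/
theorem hinj_hex_comp_of_isDeRhamAt (hP : cupLogInjective_and_hasDualExp_of_isDeRham)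
    (hDRv : GaloisRep.IsDeRham (bdRPeriodRingData (valuation_place_lt_one p v))
      (localRationalTateRep W p (galRestrictPlace v)))
    (hcont : Continuous (algebraMap (Place.Completion (Sum.inr v : Place ℚ)) L)) :
    letI := LocalField.padicAlgebra L p hL
    (bdRPeriodRingData (F := L) (p := p) hL).CupLogInjective (logCyclotomic p)
        (localRationalTateRep W p
          ((galRestrictPlace v).comp (absGaloisRestrict (Place.Completion (Sum.inr v : Place ℚ)) L))) ∧
      ∀ z : contOneCocycles (localRationalTateRep W p
          ((galRestrictPlace v).comp (absGaloisRestrict (Place.Completion (Sum.inr v : Place ℚ)) L))).toTopRep,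
        (bdRPeriodRingData (F := L) (p := p) hL).HasDualExp (logCyclotomic p)
          (localRationalTateRep W p
            ((galRestrictPlace v).comp (absGaloisRestrict (Place.Completion (Sum.inr v : Place ℚ)) L)))
          fun σ => z.1 σ := by
  letI := LocalField.padicAlgebra L p hL
  haveI : Module.Finite ℚ_[p] (W.rationalTateModule p) :=
    WeierstrassCurve.module_finite_rationalTateModule_holds W p
  exact hP hL _ (isDeRham_localRationalTateRep_comp_of_isDeRhamAt W p v hL hDRv hcont)

end Helpers

/-! ## §2 P4-coh per curve: `Ψ (Λ y) w ∈ 𝒪_w` for every `y`, `w`, from `hDRv` -/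

section Hint
open Summit.BirchSwinnertonDyer.BirchSwinnertonDyer.Theorems.KimAtThreeDeepLowerExpStarOmegaRes
open Summit.BirchSwinnertonDyer.BirchSwinnertonDyer.Theorems.KimAtThreeDeepUpperExpStarFactsTower
open Summit.BirchSwinnertonDyer.BirchSwinnertonDyer.Theorems.KimAtThreeDeepUpperTowerLattice
  (fact_natCast_mem_primesEquiv_symm)
open Summit.BirchSwinnertonDyer.BirchSwinnertonDyer.Theorems.KimAtThreeFineKatoLevelCompat
  (exists_level_towerCocycle)
open Summit.BirchSwinnertonDyer.BirchSwinnertonDyer.Theorems.KPort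
open Literature.NumberTheory.EllipticCurves.Kato2004 Literature.NumberTheory.EllipticCurves.Kato2004.EulerSystemValues
open Literature.NumberTheory.AdelicBaseChange Literature.NumberTheory.Automorphic


variable (p : ℕ) [hp : Fact p.Prime]

-- FILE-LOCAL instance keys, byte-identical to the accepted `KimAtThreeDeepUpperTowerLattice.lean` l.92–98 (no library
-- instance is overridden outside this file): the `Fact (p ∈ v_p)` key and the `ℚ_v` structure keys of §1 again.
attribute [local instance] fact_natCast_mem_primesEquiv_symm
-- the tree's `ℚ`-algebra structure on `ℚ_v` first (see `KimAtThreeDeepUpperExpStarFacts`)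
attribute [local instance 100000] NumberField.Place.instAlgebraCompletion
attribute [local instance] valuativeRelPlace topologicalSpacePlace
attribute [local instance] isNonarchimedeanLocalField_place charZero_place
attribute [local instance] padicAlgebraPlace fact_not_isUnit_place isAdicComplete_place

set_option backward.isDefEq.respectTransparency false in
set_option maxHeartbeats 1600000 in
/-- ★ **P4-coh in the P1 draft's currency, PER-CURVE de Rham re-key — the `hint` binder of P4-core.**
`…SemiLocalIntegrality.semilocal_mem_adicCompletionIntegers_of_pin_of_semi` (p603458) VERBATIM, except that the universal
cite fact hDR `isDeRham_restrictedRationalTateRep` is replaced by the de Rham-ness `hDRv` of `V_pW|_{Γ_{ℚ_v}}` of THIS curve at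
`v = (p)`: for `W/ℚ` globally minimal, `5 ≤ p` additive, `d₀` with (PIN), a level `m` with `p ∤ m`, F″'s clause, ANY `Λ`,
`Ψ`, and the per-place clause (RES_w) ∧ (DEF_w) VERBATIM ⟹ `∀ y w, Ψ (Λ y) w ∈ 𝒪_w`, GRANTED (S5b-tower) `hT₂` and
Kato's Prop. 1.2.3 `hP` (displayed). Proof: the original's, reading Prop. 1.2.3 at `ℚ_v` and at `L_w` through the §1 twins
`hinj_hex_of_isDeRhamAt` / `isDeRham_localRationalTateRep_comp_of_isDeRhamAt`.
[cite: Kato2004Asterisque, §9.4 (p. 188), Thm. 9.7 (p. 189)] [cite: Kato1993LNM1553, Ch. II Prop. 1.2.3, §1.2.4, Thm. 1.4.1 (3)–(4)]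
[cite: BlochKato1990, §3 Prop. 3.8, Ex. 3.11] [cite: KimNakamura2020, Cor. 2.4]
[cite: CasselsFrohlichANT1967, Ch. II §10 Theorem (10.2)] -/
theorem semilocal_mem_adicCompletionIntegers_of_pin_of_semi_of_isDeRhamAt
    (hT₂ : exists_smul_range_expStarCoord_tower_iff_trace_log)
    (hP : cupLogInjective_and_hasDualExp_of_isDeRham)
    (W : WeierstrassCurve ℚ) [W.IsElliptic] [W.IsGloballyMinimal]
    [ContinuousSMul ℤ_[p] (W.tateModule p)] [Module.Free ℤ_[p] (W.tateModule p)]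
    [Module.Finite ℤ_[p] (W.tateModule p)]
    (hDRv : GaloisRep.IsDeRham (bdRPeriodRingData (valuation_place_lt_one p ((primesEquiv (R := 𝓞 ℚ)).symm ⟨p, hp.out⟩)))
      (localRationalTateRep W p (galRestrictPlace ((primesEquiv (R := 𝓞 ℚ)).symm ⟨p, hp.out⟩))))
    (hp5 : 5 ≤ p) (hadd : Literature.NumberTheory.EllipticCurves.Rank1Residual.Addv W p)
    (d₀ : LocalNeronLineAt W p ((primesEquiv (R := 𝓞 ℚ)).symm ⟨p, hp.out⟩))
    (hPIN : ∀ (wv : Valuation (Place.Completion (Sum.inr ((primesEquiv (R := 𝓞 ℚ)).symm ⟨p, hp.out⟩) : Place ℚ)) ℝ≥0) [wv.Compatible]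
        [(W.baseChange (Place.Completion (Sum.inr ((primesEquiv (R := 𝓞 ℚ)).symm ⟨p, hp.out⟩) : Place ℚ))).IsIntegral wv.integer],
      ∀ a : Place.Completion (Sum.inr ((primesEquiv (R := 𝓞 ℚ)).symm ⟨p, hp.out⟩) : Place ℚ),
        (∃ η : contOneCocycles (restrictedTateRep W (Place.Completion (Sum.inr ((primesEquiv (R := 𝓞 ℚ)).symm ⟨p, hp.out⟩) : Place ℚ)) p).toTopRep,
            expStarCoord W (valuation_place_lt_one p ((primesEquiv (R := 𝓞 ℚ)).symm ⟨p, hp.out⟩)) d₀ η = a) ↔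
          ∀ P : (W.baseChange (Place.Completion (Sum.inr ((primesEquiv (R := 𝓞 ℚ)).symm ⟨p, hp.out⟩) : Place ℚ))).toAffine.Point,
            ‖Algebra.trace ℚ_[p] (Place.Completion (Sum.inr ((primesEquiv (R := 𝓞 ℚ)).symm ⟨p, hp.out⟩) : Place ℚ))
                (a * padicLogPointFiniteExt wv (W.baseChange (Place.Completion (Sum.inr ((primesEquiv (R := 𝓞 ℚ)).symm ⟨p, hp.out⟩) : Place ℚ))) p P)‖ ≤ 1)
    (m : ℕ) [NeZero m] (hpm : ¬ p ∣ m)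
    (hcl : 7 < p ∨ (Nat.Coprime (orderOf (p : ZMod m)) (p - 1) ∧
      ∀ P : (W.baseChange ℚ_[p]).toAffine.Point, p • P = 0 → P = 0))
    (Λ : H1 (tateRep W p) (rootsOfUnityFixer ℚ m) →ₗ[ℤ_[p]] ℚ_[p] ⊗[ℚ] CyclotomicField m ℚ)
    (Ψ : ℚ_[p] ⊗[ℚ] CyclotomicField m ℚ ≃ₐ[ℚ]
      (Π w : ((primesEquiv (R := 𝓞 ℚ)).symm ⟨p, hp.out⟩).Extension (𝓞 (CyclotomicField m ℚ)),
        w.1.adicCompletion (CyclotomicField m ℚ)))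
    (hSEMI : ∀ (w : ((primesEquiv (R := 𝓞 ℚ)).symm ⟨p, hp.out⟩).Extension (𝓞 (CyclotomicField m ℚ))),
      ∀ (hw : ((p : ℕ) : 𝓞 (CyclotomicField m ℚ)) ∈ w.1.asIdeal)
        [CharZero (w.1.adicCompletion (CyclotomicField m ℚ))]
        [Fact (¬ IsUnit ((p : ℕ) : integerC (w.1.adicCompletion (CyclotomicField m ℚ))))]
        [IsAdicComplete (Ideal.span {((p : ℕ) : integerC (w.1.adicCompletion (CyclotomicField m ℚ)))}) (integerC (w.1.adicCompletion (CyclotomicField m ℚ)))]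
        (hL : valuation (w.1.adicCompletion (CyclotomicField m ℚ)) ((p : ℕ) : (w.1.adicCompletion (CyclotomicField m ℚ))) < 1),
      letI := LocalField.adicCompletionPadicAlgebra w.1 p hw
      letI ρVT := (W.rationalTateGaloisRep p (W.continuous_rationalGaloisRepTate_holds p)).restrict
        ((absGaloisRestrict ℚ (Place.Completion (Sum.inr ((primesEquiv (R := 𝓞 ℚ)).symm ⟨p, hp.out⟩) : Place ℚ))).comp
          (absGaloisRestrict (((primesEquiv (R := 𝓞 ℚ)).symm ⟨p, hp.out⟩).adicCompletion ℚ) (w.1.adicCompletion (CyclotomicField m ℚ))))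
      ∃ (dw : (bdRPeriodRingData hL).FilZeroLine ρVT),
        (∀ (η₀ : contOneCocycles (restrictedTateRep W (Place.Completion (Sum.inr ((primesEquiv (R := 𝓞 ℚ)).symm ⟨p, hp.out⟩) : Place ℚ)) p).toTopRep)
          (η : contOneCocycles ((restrictedTateRep W (Place.Completion (Sum.inr ((primesEquiv (R := 𝓞 ℚ)).symm ⟨p, hp.out⟩) : Place ℚ)) p).restrict
            (absGaloisRestrict (((primesEquiv (R := 𝓞 ℚ)).symm ⟨p, hp.out⟩).adicCompletion ℚ) (w.1.adicCompletion (CyclotomicField m ℚ)))).toTopRep),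
          (∀ σ, η.1 σ = η₀.1 (absGaloisRestrict (((primesEquiv (R := 𝓞 ℚ)).symm ⟨p, hp.out⟩).adicCompletion ℚ) (w.1.adicCompletion (CyclotomicField m ℚ)) σ)) →
          (bdRPeriodRingData hL).dualExpCoord (logCyclotomic p) ρVT dw.ω (fun σ => TateModule.toRational p (η.1 σ)) =
            algebraMap (((primesEquiv (R := 𝓞 ℚ)).symm ⟨p, hp.out⟩).adicCompletion ℚ) (w.1.adicCompletion (CyclotomicField m ℚ))
              (expStarCoord W (valuation_place_lt_one p ((primesEquiv (R := 𝓞 ℚ)).symm ⟨p, hp.out⟩)) d₀ η₀ :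
                Place.Completion (Sum.inr ((primesEquiv (R := 𝓞 ℚ)).symm ⟨p, hp.out⟩) : Place ℚ))) ∧
        (∀ (y : H1 (tateRep W p) (rootsOfUnityFixer ℚ m))
          (φ'' : contOneCocycles (subgroupRep (tateRep W p).toTopRep (rootsOfUnityFixer ℚ m)))
          (ψT : contOneCocycles ((restrictedTateRep W (Place.Completion (Sum.inr ((primesEquiv (R := 𝓞 ℚ)).symm ⟨p, hp.out⟩) : Place ℚ)) p).restrict
            (absGaloisRestrict (((primesEquiv (R := 𝓞 ℚ)).symm ⟨p, hp.out⟩).adicCompletion ℚ) (w.1.adicCompletion (CyclotomicField m ℚ)))).toTopRep),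
          oneCocycleClass _ φ'' = y →
          (∀ σ (hσ : absGaloisRestrictTower ℚ (((primesEquiv (R := 𝓞 ℚ)).symm ⟨p, hp.out⟩).adicCompletion ℚ) (w.1.adicCompletion (CyclotomicField m ℚ)) σ ∈
              rootsOfUnityFixer ℚ m),
            ψT.1 σ = φ''.1 ⟨absGaloisRestrictTower ℚ (((primesEquiv (R := 𝓞 ℚ)).symm ⟨p, hp.out⟩).adicCompletion ℚ) (w.1.adicCompletion (CyclotomicField m ℚ)) σ, hσ⟩) →
          Ψ (Λ y) w =
            (bdRPeriodRingData hL).dualExpCoord (logCyclotomic p) ρVT dw.ω (fun σ => TateModule.toRational p (ψT.1 σ)))) :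
    ∀ (y : H1 (tateRep W p) (rootsOfUnityFixer ℚ m))
      (w : ((primesEquiv (R := 𝓞 ℚ)).symm ⟨p, hp.out⟩).Extension (𝓞 (CyclotomicField m ℚ))),
      Ψ (Λ y) w ∈ w.1.adicCompletionIntegers (CyclotomicField m ℚ) := by
  intro y w
  -- local-field structures at `L_w`, instantiated with the packet's own terms (as the P1 draft prescribes)
  have hw : ((p : ℕ) : 𝓞 (CyclotomicField m ℚ)) ∈ w.1.asIdeal := Kw.prime_mem_asIdeal w
  letI := LocalField.charZero_adicCompletion w.1
  letI := LocalField.adicCompletionPadicAlgebra w.1 p hw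
  haveI : Fact (¬ IsUnit ((p : ℕ) : integerC (w.1.adicCompletion (CyclotomicField m ℚ)))) :=
    ⟨not_isUnit_natCast_integerC (LocalField.valuation_adicCompletion_natCast_lt_one w.1 p hw)⟩
  haveI := isAdicComplete_integerC_natCast (LocalField.valuation_adicCompletion_natCast_lt_one w.1 p hw)
  -- `Place.Completion (inr v)` is `ℚ_v` by `rfl`: read the packet's algebra structure on it
  letI instEF : Algebra (Place.Completion (K := ℚ) (Sum.inr ((primesEquiv (R := 𝓞 ℚ)).symm ⟨p, hp.out⟩)))
      (w.1.adicCompletion (CyclotomicField m ℚ)) :=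
    inferInstanceAs (Algebra (((primesEquiv (R := 𝓞 ℚ)).symm ⟨p, hp.out⟩).adicCompletion ℚ)
      (w.1.adicCompletion (CyclotomicField m ℚ)))
  have hcont : Continuous (algebraMap (Place.Completion (K := ℚ) (Sum.inr ((primesEquiv (R := 𝓞 ℚ)).symm ⟨p, hp.out⟩)))
      (w.1.adicCompletion (CyclotomicField m ℚ))) :=
    w.adicCompletionSemialgHom_continuous ℚ (CyclotomicField m ℚ)
  -- the per-place clause of the datum at `w`
  obtain ⟨dw, hres, hdef⟩ := hSEMI w hw (LocalField.valuation_adicCompletion_natCast_lt_one w.1 p hw)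
  -- Kato's Prop. 1.2.3 binders at the base and at `L_w` (cite fact `hP`, per-curve de Rham hypothesis `hDRv`)
  obtain ⟨hinj, hex⟩ := hinj_hex_of_isDeRhamAt W p ((primesEquiv (R := 𝓞 ℚ)).symm ⟨p, hp.out⟩) hP hDRv
  haveI : Module.Finite ℚ_[p] (W.rationalTateModule p) := WeierstrassCurve.module_finite_rationalTateModule_holds W p
  have hDRw := isDeRham_localRationalTateRep_comp_of_isDeRhamAt W p ((primesEquiv (R := 𝓞 ℚ)).symm ⟨p, hp.out⟩)
    (LocalField.valuation_adicCompletion_natCast_lt_one w.1 p hw) hDRv hcont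
  obtain ⟨hinjw, hexw⟩ := hP (LocalField.valuation_adicCompletion_natCast_lt_one w.1 p hw)
    (localRationalTateRep W p ((galRestrictPlace ((primesEquiv (R := 𝓞 ℚ)).symm ⟨p, hp.out⟩)).comp
      (absGaloisRestrict (((primesEquiv (R := 𝓞 ℚ)).symm ⟨p, hp.out⟩).adicCompletion ℚ) (w.1.adicCompletion (CyclotomicField m ℚ))))) hDRw
  -- the PIN in W2's `hdual` shape
  have hdual := hdual_of_pin W p ((primesEquiv (R := 𝓞 ℚ)).symm ⟨p, hp.out⟩) d₀ hinj hex hPIN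
    (((Padic.adicCompletionEquiv (𝓞 ℚ) ⟨p, hp.out⟩).symm : (((primesEquiv (R := 𝓞 ℚ)).symm ⟨p, hp.out⟩).adicCompletion ℚ) →+* ℚ_[p]))
  -- (RES_w) on classes from the cocycle-level clause
  have hres' : ∀ h : (tateLocalRep W p (Sum.inr ((primesEquiv (R := 𝓞 ℚ)).symm ⟨p, hp.out⟩))).cohomology 1,
      expStarOmegaHom (LocalField.valuation_adicCompletion_natCast_lt_one w.1 p hw) ((galRestrictPlace ((primesEquiv (R := 𝓞 ℚ)).symm ⟨p, hp.out⟩)).comp (absGaloisRestrict (((primesEquiv (R := 𝓞 ℚ)).symm ⟨p, hp.out⟩).adicCompletion ℚ) (w.1.adicCompletion (CyclotomicField m ℚ)))) dw hinjw hexw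
          (ContinuousRep.cohomologyRes (tateLocalRep W p (Sum.inr ((primesEquiv (R := 𝓞 ℚ)).symm ⟨p, hp.out⟩))) (absGaloisRestrict (((primesEquiv (R := 𝓞 ℚ)).symm ⟨p, hp.out⟩).adicCompletion ℚ) (w.1.adicCompletion (CyclotomicField m ℚ))) 1 h) =
        algebraMap (((primesEquiv (R := 𝓞 ℚ)).symm ⟨p, hp.out⟩).adicCompletion ℚ) (w.1.adicCompletion (CyclotomicField m ℚ)) (expStarOmegaAt d₀ h) := by
    intro h
    obtain ⟨η₀, rfl⟩ := oneCocycleClass_surjective _ h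
    let ηp := contOneCocycles.pullback (absGaloisRestrict (((primesEquiv (R := 𝓞 ℚ)).symm ⟨p, hp.out⟩).adicCompletion ℚ) (w.1.adicCompletion (CyclotomicField m ℚ)))
      (Y := ((tateLocalRep W p (Sum.inr ((primesEquiv (R := 𝓞 ℚ)).symm ⟨p, hp.out⟩))).restrict (absGaloisRestrict (((primesEquiv (R := 𝓞 ℚ)).symm ⟨p, hp.out⟩).adicCompletion ℚ) (w.1.adicCompletion (CyclotomicField m ℚ)))).toTopRep)
      (TopRep.ofHom ⟨ContinuousLinearMap.id ℤ (W.tateModule p), fun _ => rfl⟩) η₀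
    have hcl' : (tateLocalRep W p (Sum.inr ((primesEquiv (R := 𝓞 ℚ)).symm ⟨p, hp.out⟩))).cohomologyRes (absGaloisRestrict (((primesEquiv (R := 𝓞 ℚ)).symm ⟨p, hp.out⟩).adicCompletion ℚ) (w.1.adicCompletion (CyclotomicField m ℚ))) 1
        (oneCocycleClass _ η₀) =
        oneCocycleClass (localTateRep W p ((galRestrictPlace ((primesEquiv (R := 𝓞 ℚ)).symm ⟨p, hp.out⟩)).comp
          (absGaloisRestrict (((primesEquiv (R := 𝓞 ℚ)).symm ⟨p, hp.out⟩).adicCompletion ℚ) (w.1.adicCompletion (CyclotomicField m ℚ))))).toTopRep ηp :=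
      KimAtThreeDeepLowerExpStarOmegaRes.cohomologyRes_oneCocycleClass _ _ η₀
    rw [hcl', expStarOmegaHom_apply, expStarOmega_oneCocycleClass, expStarOmegaAt_eq_expStarCoord]
    exact hres η₀ ηp fun σ => pullback_id_apply _ _ η₀ σ
  -- P4-coh part 1: the defined `exp*` of the tower representation at `L_w` is integral
  have hint := expStarOmegaHom_mem_adicCompletionIntegers_of_katoClause p hT₂ W hp5 hadd d₀ hinj hex hdual m hpm hcl w
    dw hinjw hexw hres'
  -- a cocycle of `y` and its tower cocycle (membership by §1 of part 2)
  obtain ⟨φ'', hφ⟩ := oneCocycleClass_surjective _ y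
  obtain ⟨ψT, hψT⟩ := exists_level_towerCocycle W p ((primesEquiv (R := 𝓞 ℚ)).symm ⟨p, hp.out⟩)
    (w.1.adicCompletion (CyclotomicField m ℚ)) (rootsOfUnityFixer ℚ m)
    (fun σ => absGaloisRestrictTower_adicCompletion_mem_rootsOfUnityFixer p m w σ) φ''
  have hΨ := hdef y φ'' ψT hφ (fun σ _ => hψT σ)
  rw [hΨ]
  have key := hint (oneCocycleClass _ ψT)
  rw [expStarOmegaHom_apply, expStarOmega_oneCocycleClass] at key
  exact key


end Hint

end Summit.BirchSwinnertonDyer.BirchSwinnertonDyer.Theorems.SemiLocalIntegralityAt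

end
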